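import Summits.CriticalPhenomena.SAWScalingLimit.Theorems.SAWLeftRightFKGFKGToTraversalBoundSlitNecklaceDefs
import Summits.CriticalPhenomena.SAWScalingLimit.Theorems.SAWLeftRightFKGFKGToTraversalBoundSweep
import Summits.CriticalPhenomena.SAWScalingLimit.Theorems.SAWLeftRightFKGFKGToTraversalBoundSlitPresentation
import Summits.CriticalPhenomena.SAWScalingLimit.Theorems.SAWLeftRightFKGLeftRightFKGRectBoundaryWalk
import Summits.CriticalPhenomena.SAWScalingLimit.Theorems.LeftRightFKG.Negative.RectMesh
import HarnessLib

/-!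
# Tame presentation of a hole-free induced discretisation (stubs `tamePresentation_of_holeFree[_conn]`)

Crux `SAWLeftRightFKG.FKGToTraversalBound` (stmt-CriticalPhenomena-1878), line `slit-necklace`, registered stubs
`tamePresentation_of_holeFree_conn` and `tamePresentation_of_holeFree` (the same statement without the
connectivity hypothesis).  `TamePresentation Ω δ N₀`
(`Theorems/SAWLeftRightFKGFKGToTraversalBoundSlitNecklaceDefs.lean`) asks for a closed lattice walk `C` and at
most `N₀` defect sites `S` with `(dom C δ)_δ = Ω_δ ∖ S` as graphs; the necklace reduction of the line is landed on
EVENTUALLY TAME domains, and this file is the general tool certifying tameness with NO defect (`N₀ = 0`, `S = ∅`).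

**Statement.**  Let `W = meshDomain Ω δ` (`δ > 0`) sit strictly inside the lattice rectangle `[x₀, x₁] × [y₀, y₁]`,
be an INDUCED subgraph of `ℤ²` (lattice-adjacent sites of `W` are mesh-adjacent), and be HOLE-FREE: every site of
the closed rectangle off `W` is joined to a wall of the rectangle by a lattice walk through sites of the closed
rectangle off `W`.  Then `TamePresentation Ω δ 0` (`tamePresentation_of_holeFree`; the registered variant
`tamePresentation_of_holeFree_conn` carries a redundant connectivity hypothesis).

**Proof** (everything at mesh `1`, then `CornerLoc.discreteDomainGraph_dom`).  Take the boundary walk `C` of the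
rectangle (`Families.stub_rectBoundaryWalk`); by the `Rect` API (`Rect.meshVertices_Ω`, `Rect.Rint_subset_Ω`) its
carrier `dom C 1` has the open box of sites as mesh vertices.  Sweep the finite set `K` of box sites off `W` into
the walk (`ExcursionDomination.stub_sweep`; the attachment hypothesis is hole-freeness: an escape walk runs through
`K` until it hits a wall site, a vertex of `C`).  For the swept walk `C'` (`C'.support = C.support ∪ K`, index
unchanged off its trace) the mesh vertices of `dom C' 1` are exactly `W` and lattice-adjacent sites of `W` are
mesh-adjacent (`ExcursionDomination.meshGraph_adj_of_adj`), so the two mesh graphs agree on `W` (`sweep_box`).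
The largest-component convention is then idempotent (`meshDomain_eq_meshVertices_of_presents`: the components of the
new mesh-vertex graph are the maximal components of the old one — same vertices over `W`, same edges — hence all of
the same size, hence all maximal), so `meshDomain (dom C' 1) 1 = W` and the adjacency of `(dom C' 1)_1` is lattice
adjacency on `W`, which is that of `Ω_δ`.  The degenerate case `W = ∅` uses the unit square.
Template: `ExcursionDomination.slitPresentation_one`.  No named fact; axioms are the standard three.
-/

noncomputable section

open Set
open Literature.Probability.LatticeModels Literature.Probability.RandomPlanarGeometry
open Literature.Topology.PlaneTopology
open Summit.CriticalPhenomena.SAWScalingLimit.Theorems.FKGToTraversalBound.Negative (dom notMem_dom_of_mem_support)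

namespace Summit.CriticalPhenomena.SAWScalingLimit.Theorems.FKGToTraversalBound.SlitNecklace

open Summit.CriticalPhenomena.SAWScalingLimit.Theorems.LeftRightFKG.Negative
open Summit.CriticalPhenomena.SAWScalingLimit.Theorems.LeftRightFKG.CornerLoc
  (isBounded_dom discreteDomainGraph_dom)
open Summit.CriticalPhenomena.SAWScalingLimit.Theorems.LeftRightFKG.Families (stub_rectBoundaryWalk)
open Summit.CriticalPhenomena.SAWScalingLimit.Theorems.FKGToTraversalBound.ExcursionDomination
  (stub_sweep mem_support_of_pt_mem_range notMem_range_of_mem_dom notMem_support_of_mem_meshVertices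
    meshGraph_adj_of_adj)

/-! ### Graph-theoretic plumbing: the largest-component convention is idempotent -/

/-- A walk of the graph induced by `G` on `A`, all of whose vertices lie in a set `P` on which `G`-adjacency
implies `H`-adjacency, joins its endpoints in the graph induced by `H` on any `B ⊇ P`. [folklore] -/
theorem reachable_induce_of_induce_walk {V : Type*} {G H : SimpleGraph V} {A P B : Set V} (hPB : P ⊆ B)
    (hGH : ∀ ⦃x y : V⦄, x ∈ P → y ∈ P → G.Adj x y → H.Adj x y) :
    ∀ {u v : A} (q : (G.induce A).Walk u v), (∀ x ∈ q.support, (x : V) ∈ P) →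
      ∀ (hu : (u : V) ∈ B) (hv : (v : V) ∈ B), (H.induce B).Reachable ⟨u, hu⟩ ⟨v, hv⟩ := by
  intro u v q
  induction q with
  | nil => intro _ hu hv; exact SimpleGraph.Reachable.refl _
  | @cons a b _ h q ih =>
    intro hq hu hv
    have haP : (a : V) ∈ P := hq a (SimpleGraph.Walk.start_mem_support _)
    have hbP : (b : V) ∈ P :=
      hq b (by rw [SimpleGraph.Walk.support_cons]; exact List.mem_cons_of_mem _ q.start_mem_support)
    have hadj : (H.induce B).Adj ⟨a, hu⟩ ⟨b, hPB hbP⟩ := hGH haP hbP h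
    exact hadj.reachable.trans (ih (fun x hx => hq x (by
      rw [SimpleGraph.Walk.support_cons]; exact List.mem_cons_of_mem _ hx)) (hPB hbP) hv)

/-- **Components over a sub-vertex-set with the same edges.**  Let `T ⊆ S`, let `G` and `H` have the same edges
between vertices of `T`, and let `K` be a component of `G` induced on `S` lying over `T`.  Then the component of
`H` induced on `T` through any vertex over `K` has the same underlying set of vertices as `K`. [folklore] -/
theorem image_supp_eq {V : Type*} {G H : SimpleGraph V} {S T : Set V} (hTS : T ⊆ S)
    (hGH : ∀ ⦃x y : V⦄, x ∈ T → y ∈ T → (G.Adj x y ↔ H.Adj x y))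
    (K : (G.induce S).ConnectedComponent) (hK : Subtype.val '' K.supp ⊆ T) (v : T)
    (hv : (v : V) ∈ Subtype.val '' K.supp) :
    Subtype.val '' ((H.induce T).connectedComponentMk v).supp = Subtype.val '' K.supp := by
  classical
  obtain ⟨v₀, hv₀, hv₀v⟩ := hv
  obtain rfl : v₀ = ⟨(v : V), hTS v.2⟩ := Subtype.ext hv₀v
  ext u
  constructor
  · rintro ⟨u', hu', rfl⟩
    obtain ⟨q⟩ := SimpleGraph.ConnectedComponent.exact hu'
    have hr : (G.induce S).Reachable ⟨u', hTS u'.2⟩ ⟨v, hTS v.2⟩ :=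
      reachable_induce_of_induce_walk (G := H) (H := G) (A := T) (P := T) (B := S) hTS
        (fun x y hx hy h => (hGH hx hy).2 h) q (fun x _ => x.2) (hTS u'.2) (hTS v.2)
    refine ⟨⟨u', hTS u'.2⟩, ?_, rfl⟩
    rw [SimpleGraph.ConnectedComponent.mem_supp_iff] at hv₀ ⊢
    rw [← hv₀]
    exact SimpleGraph.ConnectedComponent.sound hr
  · rintro ⟨u₀, hu₀, rfl⟩
    obtain ⟨q⟩ : (G.induce S).Reachable ⟨(v : V), hTS v.2⟩ u₀ :=
      SimpleGraph.ConnectedComponent.exact (hv₀.trans hu₀.symm)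
    -- every vertex of `q` lies in `K`, hence over `T`
    have hqT : ∀ y ∈ q.support, (y : V) ∈ T := fun y hy =>
      hK ⟨y, (SimpleGraph.ConnectedComponent.sound ⟨q.takeUntil y hy⟩).symm.trans hv₀, rfl⟩
    have hr : (H.induce T).Reachable ⟨(v : V), v.2⟩ ⟨u₀, hqT u₀ q.end_mem_support⟩ :=
      reachable_induce_of_induce_walk (G := G) (H := H) (A := S) (P := T) (B := T) Subset.rfl
        (fun x y hx hy h => (hGH hx hy).1 h) q hqT v.2 (hqT u₀ q.end_mem_support)
    exact ⟨⟨u₀, hqT u₀ q.end_mem_support⟩, SimpleGraph.ConnectedComponent.sound hr.symm, rfl⟩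

/-- **The largest-component convention is idempotent.**  If the mesh vertices of `(Ω', δ')` are exactly the
discrete domain `W = meshDomain Ω δ` of `(Ω, δ)` and the two mesh graphs have the same edges between sites of `W`,
then `meshDomain Ω' δ' = W`: the components of the new mesh-vertex graph are the maximal components of the old one,
all of the same size, so all of them are maximal. [folklore] -/
theorem meshDomain_eq_meshVertices_of_presents {Ω Ω' : Set ℂ} {δ δ' : ℝ}
    (hV : ∀ x, x ∈ meshVertices Ω' δ' ↔ x ∈ meshDomain Ω δ)
    (hA : ∀ x ∈ meshDomain Ω δ, ∀ y ∈ meshDomain Ω δ, (meshGraph Ω' δ').Adj x y ↔ (meshGraph Ω δ).Adj x y) :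
    meshDomain Ω' δ' = meshVertices Ω' δ' := by
  have hTS : meshVertices Ω' δ' ⊆ meshVertices Ω δ := fun x hx =>
    meshDomain_subset_meshVertices _ _ ((hV x).1 hx)
  have hGH : ∀ ⦃x y : Site 2⦄, x ∈ meshVertices Ω' δ' → y ∈ meshVertices Ω' δ' →
      ((meshGraph Ω δ).Adj x y ↔ (meshGraph Ω' δ').Adj x y) := fun x y hx hy =>
    (hA x ((hV x).1 hx) y ((hV y).1 hy)).symm
  -- the component of every new vertex has the maximal old size
  have key : ∀ v : meshVertices Ω' δ', ∃ K : (meshVertexGraph Ω δ).ConnectedComponent,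
      (∀ K' : (meshVertexGraph Ω δ).ConnectedComponent, K'.supp.ncard ≤ K.supp.ncard) ∧
      ((meshVertexGraph Ω' δ').connectedComponentMk v).supp.ncard = K.supp.ncard := by
    intro v
    have hvW : (v : Site 2) ∈ meshDomain Ω δ := (hV v).1 v.2
    simp only [meshDomain, Set.mem_iUnion] at hvW
    obtain ⟨K, hK, hvK⟩ := hvW
    have hKW : Subtype.val '' K.supp ⊆ meshVertices Ω' δ' := fun x hx => (hV x).2 (by
      simp only [meshDomain, Set.mem_iUnion]; exact ⟨K, hK, hx⟩)
    refine ⟨K, hK, ?_⟩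
    rw [← Set.ncard_image_of_injective _ Subtype.val_injective,
      ← Set.ncard_image_of_injective K.supp Subtype.val_injective, image_supp_eq hTS hGH K hKW v hvK]
  refine Set.Subset.antisymm (meshDomain_subset_meshVertices _ _) fun x hx => ?_
  simp only [meshDomain, Set.mem_iUnion, Set.mem_image]
  obtain ⟨K, hK, hKx⟩ := key ⟨x, hx⟩
  refine ⟨(meshVertexGraph Ω' δ').connectedComponentMk ⟨x, hx⟩, fun K'' => ?_, ⟨x, hx⟩, rfl, rfl⟩
  induction K'' using SimpleGraph.ConnectedComponent.ind with
  | h u =>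
    obtain ⟨Ku, -, hKu⟩ := key u
    rw [hKx, hKu]
    exact hK Ku

/-! ### The sweep of a hole-free set of box sites at mesh `1` -/

/-- **Sweeping the box sites off `W` into the boundary walk.**  For a lattice rectangle `[x₀, x₁] × [y₀, y₁]`
(`x₀ < x₁`, `y₀ < y₁`) and a set `W` of sites strictly inside it, hole-free in the closed rectangle, the boundary
walk of the rectangle swept through the box sites off `W` is a closed lattice walk `C'` whose carrier `dom C' 1` has
mesh vertices exactly `W`, lattice-adjacent sites of `W` being mesh-adjacent. [folklore] -/
theorem sweep_box {x₀ x₁ y₀ y₁ : ℤ} (hx : x₀ < x₁) (hy : y₀ < y₁) (W : Set (Site 2))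
    (hWbox : ∀ x ∈ W, x₀ < x 0 ∧ x 0 < x₁ ∧ y₀ < x 1 ∧ x 1 < y₁)
    (hfree : ∀ k : Site 2, x₀ ≤ k 0 → k 0 ≤ x₁ → y₀ ≤ k 1 → k 1 ≤ y₁ → k ∉ W →
      ∃ (q : Site 2) (p : (zdGraph 2).Walk k q), (q 0 = x₀ ∨ q 0 = x₁ ∨ q 1 = y₀ ∨ q 1 = y₁) ∧
        ∀ z ∈ p.support, z ∉ W ∧ x₀ ≤ z 0 ∧ z 0 ≤ x₁ ∧ y₀ ≤ z 1 ∧ z 1 ≤ y₁) :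
    ∃ C' : (zdGraph 2).Walk (bx x₀ y₀) (bx x₀ y₀),
      (∀ x : Site 2, x ∈ meshVertices (dom C' 1) 1 ↔ x ∈ W) ∧
      ∀ x y : Site 2, x ∈ W → y ∈ W → (zdGraph 2).Adj x y → (meshGraph (dom C' 1) 1).Adj x y := by
  classical
  -- the boundary walk of the rectangle and its carrier
  obtain ⟨C, hb, hch, hcomp, hcross⟩ := stub_rectBoundaryWalk x₀ x₁ y₀ y₁ hx hy
  have hface : x₀ ≤ x₀ ∧ x₀ + 1 ≤ x₁ ∧ y₀ ≤ y₀ ∧ y₀ + 1 ≤ y₁ := ⟨le_rfl, by omega, le_rfl, by omega⟩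
  have hcross' : pathCross x₀ y₀ (bx x₀ y₀) C.support.tail ≠ 0 := by rw [hcross]; decide
  have hV : meshVertices (dom C 1) 1 = Rect.box x₀ x₁ y₀ y₁ := Rect.meshVertices_Ω hb hch hcomp hface hcross'
  have hRint : Rect.Rint x₀ x₁ y₀ y₁ ⊆ dom C 1 := Rect.Rint_subset_Ω hb hch hface hcross'
  have hWbox' : ∀ x ∈ W, x ∈ Rect.box x₀ x₁ y₀ y₁ := fun x hx =>
    ⟨⟨(hWbox x hx).1, (hWbox x hx).2.1⟩, (hWbox x hx).2.2.1, (hWbox x hx).2.2.2⟩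
  have hWV : ∀ x ∈ W, x ∈ meshVertices (dom C 1) 1 := fun x hx => by rw [hV]; exact hWbox' x hx
  have hW_notC : ∀ x ∈ W, x ∉ C.support := fun x hx => notMem_support_of_mem_meshVertices C 1 (hWV x hx)
  -- the sweep set `K`: box sites off `W`
  have hVfin : (meshVertices (dom C 1) 1).Finite := meshVertices_finite (isBounded_dom C 1) one_pos
  set K : Finset (Site 2) := hVfin.toFinset.filter (fun v => v ∉ W) with hKdef
  have hKmem : ∀ k, k ∈ K ↔ k ∈ Rect.box x₀ x₁ y₀ y₁ ∧ k ∉ W := fun k => by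
    rw [hKdef, Finset.mem_filter, Set.Finite.mem_toFinset, hV]
  -- every site of `K` is attached to `C` through `K ∪ C.support` (hole-freeness)
  have hatt : ∀ k ∈ K, ∃ (q : Site 2) (p : (zdGraph 2).Walk k q), q ∈ C.support ∧
      ∀ x ∈ p.support, x ∈ K ∨ x ∈ C.support := by
    intro k hk
    obtain ⟨⟨⟨h1, h2⟩, h3, h4⟩, hkW⟩ := (hKmem k).1 hk
    obtain ⟨q, p, hq, hp⟩ := hfree k h1.le h2.le h3.le h4.le hkW
    have hwall : ∀ z ∈ p.support, (z 0 = x₀ ∨ z 0 = x₁ ∨ z 1 = y₀ ∨ z 1 = y₁) → z ∈ C.support := by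
      intro z hz hzw
      obtain ⟨-, hz1, hz2, hz3, hz4⟩ := hp z hz
      have h := hcomp (z 0) (z 1) hz1 hz2 hz3 hz4 hzw
      rwa [← eq_bx z] at h
    refine ⟨q, p, hwall q p.end_mem_support hq, fun z hz => ?_⟩
    by_cases hzw : z 0 = x₀ ∨ z 0 = x₁ ∨ z 1 = y₀ ∨ z 1 = y₁
    · exact Or.inr (hwall z hz hzw)
    · obtain ⟨hzW, hz1, hz2, hz3, hz4⟩ := hp z hz
      refine Or.inl ((hKmem z).2 ⟨⟨⟨?_, ?_⟩, ?_, ?_⟩, hzW⟩) <;> omega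
  -- sweep
  obtain ⟨C', hC'supp, hC'wind⟩ := stub_sweep _ C K hatt
  have hW_notC' : ∀ x ∈ W, x ∉ C'.support := fun x hx h =>
    ((hC'supp x).1 h).elim (hW_notC x hx) (fun hK => ((hKmem x).1 hK).2 hx)
  -- the new mesh vertices are `W` (the index is unchanged off the new trace)
  have hV' : ∀ x, x ∈ meshVertices (dom C' 1) 1 ↔ x ∈ W := by
    intro x
    rw [mem_meshVertices_iff, meshPoint_one]
    constructor
    · intro hx'
      have hxT' : pt x ∉ Set.range (C'.toCurve (meshPoint 1)) := notMem_range_of_mem_dom C' 1 hx'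
      obtain ⟨-, hw⟩ := hC'wind 1 (pt x) one_pos hxT'
      have hxV : x ∈ meshVertices (dom C 1) 1 := by
        rw [mem_meshVertices_iff, meshPoint_one]; change wind _ ≠ 0; rw [← hw]; exact hx'
      have hxC' : x ∉ C'.support := fun h =>
        hxT' (by simpa only [meshPoint_one] using C'.mem_range_toCurve (meshPoint 1) h)
      by_contra hxW
      exact hxC' ((hC'supp x).2 (Or.inr ((hKmem x).2 ⟨hV ▸ hxV, hxW⟩)))
    · intro hx'
      have hxV : pt x ∈ dom C 1 := hRint (Rect.pt_mem_Rint_of_box (hWbox' x hx'))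
      obtain ⟨-, hw⟩ := hC'wind 1 (pt x) one_pos fun h => hW_notC' x hx' (mem_support_of_pt_mem_range C' h)
      change wind _ ≠ 0; rw [hw]; exact hxV
  -- adjacent sites of `W` are joined in the new mesh graph
  exact ⟨C', hV', fun x y hx' hy' hxy => meshGraph_adj_of_adj C' hxy ((hV' x).2 hx') (hW_notC' y hy')⟩

/-- **Presentation of a hole-free induced discrete domain at mesh `1`.**  If `W = meshDomain Ω δ` lies strictly
inside the lattice rectangle `[x₀, x₁] × [y₀, y₁]` (`x₀ < x₁`, `y₀ < y₁`), is induced and hole-free, then the swept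
boundary walk `C'` of `sweep_box` has `(dom C' 1)_1`-adjacency = lattice adjacency on `W`
(`meshDomain_eq_meshVertices_of_presents`). [folklore] -/
theorem presentation_one {x₀ x₁ y₀ y₁ : ℤ} (hx : x₀ < x₁) (hy : y₀ < y₁) {Ω : Set ℂ} {δ : ℝ}
    (hbox : ∀ x ∈ meshDomain Ω δ, x₀ < x 0 ∧ x 0 < x₁ ∧ y₀ < x 1 ∧ x 1 < y₁)
    (hind : ∀ x ∈ meshDomain Ω δ, ∀ y ∈ meshDomain Ω δ, (zdGraph 2).Adj x y → (meshGraph Ω δ).Adj x y)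
    (hfree : ∀ k : Site 2, x₀ ≤ k 0 → k 0 ≤ x₁ → y₀ ≤ k 1 → k 1 ≤ y₁ → k ∉ meshDomain Ω δ →
      ∃ (q : Site 2) (p : (zdGraph 2).Walk k q), (q 0 = x₀ ∨ q 0 = x₁ ∨ q 1 = y₀ ∨ q 1 = y₁) ∧
        ∀ z ∈ p.support, z ∉ meshDomain Ω δ ∧ x₀ ≤ z 0 ∧ z 0 ≤ x₁ ∧ y₀ ≤ z 1 ∧ z 1 ≤ y₁) :
    ∃ C' : (zdGraph 2).Walk (bx x₀ y₀) (bx x₀ y₀), ∀ x y : Site 2,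
      (discreteDomainGraph (dom C' 1) 1).Adj x y ↔
        ((zdGraph 2).Adj x y ∧ x ∈ meshDomain Ω δ ∧ y ∈ meshDomain Ω δ) := by
  obtain ⟨C', hV', hmesh'⟩ := sweep_box hx hy (meshDomain Ω δ) hbox hfree
  have hD' : meshDomain (dom C' 1) 1 = meshVertices (dom C' 1) 1 :=
    meshDomain_eq_meshVertices_of_presents hV' fun x hx' y hy' =>
      ⟨fun h => hind x hx' y hy' (meshGraph_le_zdGraph _ _ h),
        fun h => hmesh' x y hx' hy' (meshGraph_le_zdGraph _ _ h)⟩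
  refine ⟨C', fun x y => ?_⟩
  rw [discreteDomainGraph_adj_iff, hD', hV', hV']
  constructor
  · rintro ⟨hm', hx', hy'⟩
    exact ⟨meshGraph_le_zdGraph _ _ hm', hx', hy'⟩
  · rintro ⟨hG', hx', hy'⟩
    exact ⟨hmesh' x y hx' hy' hG', hx', hy'⟩

/-! ### The registered stubs -/

/-- **Registered stub `tamePresentation_of_holeFree`** (line `slit-necklace`, crux stmt-CriticalPhenomena-1878).
If the discrete domain `W = meshDomain Ω δ` (`δ > 0`) lies strictly inside the lattice rectangle
`[x₀, x₁] × [y₀, y₁]`, is an induced subgraph of `ℤ²` (lattice-adjacent sites of `W` are mesh-adjacent), and every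
site of the closed rectangle off `W` escapes to a wall through sites of the closed rectangle off `W` (hole-free),
then `Ω_δ` IS the graph of an r2 carrier with no defect: `TamePresentation Ω δ 0`.  No connectivity of `W` is
needed (when several components of the mesh graph have the maximal size, `W` is their union and the presentation
reproduces exactly these components, `meshDomain_eq_meshVertices_of_presents`).  Reduced to mesh `1`
(`presentation_one`, `CornerLoc.discreteDomainGraph_dom`); the empty domain is presented by the unit square.
[folklore] -/
theorem tamePresentation_of_holeFree : ∀ (Ω : Set ℂ) (δ : ℝ) (x₀ x₁ y₀ y₁ : ℤ), 0 < δ →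
    (∀ x ∈ meshDomain Ω δ, x₀ < x 0 ∧ x 0 < x₁ ∧ y₀ < x 1 ∧ x 1 < y₁) →
    (∀ x ∈ meshDomain Ω δ, ∀ y ∈ meshDomain Ω δ, (zdGraph 2).Adj x y → (meshGraph Ω δ).Adj x y) →
    (∀ k : Site 2, x₀ ≤ k 0 → k 0 ≤ x₁ → y₀ ≤ k 1 → k 1 ≤ y₁ → k ∉ meshDomain Ω δ →
      ∃ (q : Site 2) (p : (zdGraph 2).Walk k q), (q 0 = x₀ ∨ q 0 = x₁ ∨ q 1 = y₀ ∨ q 1 = y₁) ∧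
        ∀ z ∈ p.support, z ∉ meshDomain Ω δ ∧ x₀ ≤ z 0 ∧ z 0 ≤ x₁ ∧ y₀ ≤ z 1 ∧ z 1 ≤ y₁) →
    TamePresentation Ω δ 0 := by
  intro Ω δ x₀ x₁ y₀ y₁ hδ hbox hind hfree
  -- a closed lattice walk presenting `W = meshDomain Ω δ` at mesh `1`
  obtain ⟨c, C', hC'⟩ : ∃ (c : Site 2) (C' : (zdGraph 2).Walk c c), ∀ x y : Site 2,
      (discreteDomainGraph (dom C' 1) 1).Adj x y ↔
        ((zdGraph 2).Adj x y ∧ x ∈ meshDomain Ω δ ∧ y ∈ meshDomain Ω δ) := by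
    rcases (meshDomain Ω δ).eq_empty_or_nonempty with hW | ⟨x, hx⟩
    · -- empty domain: the unit square, nothing to sweep
      obtain ⟨C', hC'⟩ := presentation_one (Ω := Ω) (δ := δ) zero_lt_one zero_lt_one
        (fun x hx => absurd hx (by rw [hW]; exact fun h => h)) hind fun k h1 h2 h3 h4 _ => by
          refine ⟨k, SimpleGraph.Walk.nil, by omega, fun z hz => ?_⟩
          rw [SimpleGraph.Walk.support_nil, List.mem_singleton] at hz
          subst hz
          exact ⟨by rw [hW]; exact fun h => h, h1, h2, h3, h4⟩
      exact ⟨_, C', hC'⟩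
    · obtain ⟨h1, h2, h3, h4⟩ := hbox x hx
      obtain ⟨C', hC'⟩ := presentation_one (by omega) (by omega) hbox hind hfree
      exact ⟨_, C', hC'⟩
  refine ⟨c, C', ∅, by simp, fun x y => ?_⟩
  rw [show discreteDomainGraph (dom C' δ) δ = discreteDomainGraph (dom C' 1) 1 from
    discreteDomainGraph_dom C' hδ.ne', hC', discreteDomainGraph_adj_iff]
  simp only [Finset.notMem_empty, not_false_eq_true, and_true]
  constructor
  · rintro ⟨h, hx, hy⟩
    exact ⟨hind x hx y hy h, hx, hy⟩
  · rintro ⟨h, hx, hy⟩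
    exact ⟨meshGraph_le_zdGraph _ _ h, hx, hy⟩

/-- **Registered stub `tamePresentation_of_holeFree_conn`** (line `slit-necklace`, crux stmt-CriticalPhenomena-1878):
as `tamePresentation_of_holeFree`, with the (redundant) hypothesis that `W = meshDomain Ω δ` is `ℤ²`-connected through
itself. [folklore] -/
theorem tamePresentation_of_holeFree_conn : ∀ (Ω : Set ℂ) (δ : ℝ) (x₀ x₁ y₀ y₁ : ℤ), 0 < δ →
    (∀ x ∈ meshDomain Ω δ, x₀ < x 0 ∧ x 0 < x₁ ∧ y₀ < x 1 ∧ x 1 < y₁) →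
    (∀ x ∈ meshDomain Ω δ, ∀ y ∈ meshDomain Ω δ, (zdGraph 2).Adj x y → (meshGraph Ω δ).Adj x y) →
    (∀ x ∈ meshDomain Ω δ, ∀ y ∈ meshDomain Ω δ,
      ∃ p : (zdGraph 2).Walk x y, ∀ z ∈ p.support, z ∈ meshDomain Ω δ) →
    (∀ k : Site 2, x₀ ≤ k 0 → k 0 ≤ x₁ → y₀ ≤ k 1 → k 1 ≤ y₁ → k ∉ meshDomain Ω δ →
      ∃ (q : Site 2) (p : (zdGraph 2).Walk k q), (q 0 = x₀ ∨ q 0 = x₁ ∨ q 1 = y₀ ∨ q 1 = y₁) ∧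
        ∀ z ∈ p.support, z ∉ meshDomain Ω δ ∧ x₀ ≤ z 0 ∧ z 0 ≤ x₁ ∧ y₀ ≤ z 1 ∧ z 1 ≤ y₁) →
    TamePresentation Ω δ 0 :=
  fun Ω δ x₀ x₁ y₀ y₁ hδ hbox hind _ hfree => tamePresentation_of_holeFree Ω δ x₀ x₁ y₀ y₁ hδ hbox hind hfree

end Summit.CriticalPhenomena.SAWScalingLimit.Theorems.FKGToTraversalBound.SlitNecklace

end
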